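import Summits.QuantumFields.BalabanUV.T4Continuum.Support.ShellMeasureAverageLocality148
import Summits.QuantumFields.BalabanUV.T4Continuum.Support.ShellMeasureLandauCorrectionReal
import Summits.QuantumFields.BalabanUV.T4Continuum.Support.ShellMeasureLandauCorrectionB7Flat

/-!
# `T4Continuum.ShellMeasureLandauCorrectionB7Local` — row S64 LOCATED: END-II's Landau-correction pair `hCq` ∕ `hCd` for
# B7's `C_k(U₀, ·)` (`ShellMeasureLandauCorrectionB7.landauCf`) FROM PLAQUETTE REGULARITY OF THE BACKGROUND ON THE BOXES
# `B^k(c₋) ∪ B^k(c₊)`, `c ∈ S′`, ALONE — nothing asked off the boxes (the k-fold twin of S91 f4)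
(cell `pub-balaban`, sub-cell `t4`, spine estimate NE7c (node U5b); NE7c ROUND-2 crew `t4-ne7c-formalise-*`, seat
`b2b-balaban-t4-ne7c-formalise-leaf-07` gen 9; own-initiative companion of owner-table row **S64** «W-a (Cf) JUNCTION INTO
END-II» (`t4/b2b-balaban-t4-ne7c-p1/LEAVES-NE7c-P1.md` v3.9.3; journal OFFER «γ14-R11 IN KERNEL» l.20076) — file 1;
ADDITIVE — imports row S68 (b) `ShellMeasureAverageLocality148`, row S64 f2 `ShellMeasureLandauCorrectionReal` and row S64 f3
`ShellMeasureLandauCorrectionB7Flat` ONLY (hence S64 `ShellMeasureLandauCorrectionB7` and b07's `B7Prop1Local`); [folklore]; 0 `def`,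
0 `def … : Prop`, 0 sorry, 0 new citation.)

HONEST FRAMING.  Finite four-torus programme, rung (B)+1 only — NOT infinite volume, NOT a mass gap, NOT the Clay
problem, NOT summit progress; (B), `BetaPertHyp`, (B^μ) not consumed.  NE7c (`T4IndicatorShell.ShellWeightBound`) is NOT
PRINTED in [Balaban 1983–89] and NOT PROVED; «NE7c ⇐ the named binders» (trigger c3).  The plaquette regularity of the
background (B11 (19)–(21) ∕ B14 (2.16)–(2.17) TYPE for Bałaban's minimisers; [Balaban1985Averaging] (52)) stays a DISPLAYED
binder — LOCATED here (the boxes of the coarse bonds read, instead of all of `ℤᵈ`), not discharged; the identification of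
END-II's `Cf` slot with this `C_k` and of `U₀` with the section's background is the [dict] reading (node O).  NOTHING in the
countdown moves; spine PROVED 0∕9.  HONEST DEPENDENCY (cell, verbatim): continuum YM on T⁴ ⇐ BetaPertH ∧ nine spine
estimates (0/9 proved); BetaPertH ⇐ (D1) ∧ (D4) ∧ CAP+tail; G-an2-4 gates asym, D1 and NE2/3/4.

THE POINT (owner g34's lens γ14, `gen34/handoff_g34.md`: «is the END's `hCq hCd` literally suppliable from S64 for OUR `Cf`?»).
Row S64 `landauCorrection_binders` (p221284) concludes EXACTLY END-II's pair — `∀ A, ‖A‖ < RC → ‖Cf A‖ ≤ C₂‖A‖²`,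
`DifferentiableOn ℂ Cf (ball 0 RC)`, `Cf := landauCf L U₀ k S S′`, `C₂ := C2cov d`, `RC := landauRad d L`, k-uniform — but
under the background binder `h52 : pdev U₀ < α₀·L^{−2k}`, a supremum over EVERY unit plaquette of `ℤᵈ`
(`B7Prop2Explicit.pdev`).  The map itself reads `U₀` only on the box `B^k(c₋) ∪ B^k(c₊)` of each output bond `c`
(print p. 31 «these averages have the same locality properties as the averages Ū^k»; p. 24; kernel: S68 (b)
`logCovIter_congr` ∕ `linCovIter_congr`, background included).  At a live slot the section's background is plaquette-regular
on its block only, so the GLOBAL binder is not inhabitable by the designed object (the γ3′ ∕ F-ne7cp1-g30-1 pattern; S91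
located the one-step average's `C̃`, not S64's k-fold `C_k`).  THIS FILE: S64's pair VERBATIM from the LOCATED binder
`∀ c ∈ S′, pdevOn (loK L k c₋) (bondHiK L k c₋ κ) U₀ < α₀·L^{−2k}` — proof = b07's clamped extension per output bond,
exactly as `B7Prop1Local.prop2_local` (print p. 26 «it is enough to assume (52) for p ⊂ B^k(x) ∪ …»): `clampCfg` agrees
with `U₀` on the box, is `G`-valued, `pdev (clampCfg …) ≤ pdevOn … U₀`, S64 applies to it, and component `c` of `landauCf`
is the same for both backgrounds; the sup norm and `differentiableOn_pi` reassemble the vector.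

WHAT IS PROVED ([folklore]; `𝔸` a complete normed `ℂ`-algebra with `‖1‖ = 1`, e.g. `M_N(ℂ)`).
§1 `landauCf_congr_background` — `landauCf L U₀ k S S′ A c` depends on `U₀` only through the bonds of
   `[loK L k c₋, bondHiK L k c₋ κ]`; `loK_le_bondHiK`; `pdevOn_le_of_forall` (a located plaquette bound `≤ a` bounds `pdevOn`),
   `pdevOn_le_pdev` (S64's global binder implies the located one: `h52loc_of_h52`).
§2 **`norm_landauCf_apply_le_local`**, **`norm_landauCf_le_local`**, **`differentiableOn_landauCf_local`**,
   **`landauCorrection_binders_local`** (THE PAIR, S64's constants), **`landauCorrection_quadAnalytic_local`** (B13's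
   `QuadAnalytic` form) — hypotheses = S64's with `h52` replaced by `h52loc`.
§3 **`landauCorrection_binders_of_plaqSmall`** ∕ **`…_of_cotests`** — the same read off a plaquette bound `‖U₀(∂p) − 1‖ ≤ a`
   on the boxes (resp. on ANY plaquette set `P ⊇` the boxes' plaquettes), `0 ≤ a < α₀·L^{−2k}` — the shape a live slot's
   CORE + COLLAR readings deliver for the section's background once node O identifies it (S80 f6 `hcore`∕`hcollar` TYPE).
§4 (C⋆-algebra `𝔸`, UNITARY background) **`landauCf_mem_skewPi_local`**, **`landauCorrection_real_binders_local`** — row S64 f2's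
   THIRD binder `hCr` («real (skew) fields to real fields») and the cut-off triple `hCq`∕`hCd`∕`hCr` + `IsClosed (skewPi S′)` for
   `(ball 0 RC).indicator (landauCf …)`, from the located binder (S64 f2 `landauCf_mem_skewPi` for the clamped background,
   membership in `skewPi` being coordinatewise).
§5 THE FLAT FACE (the LOCALIZED tuple's case — its DEFINED plaquette variables are `holOf (ℓs p) Z` of the exponent field ALONE,
   `= 1` at the chart centre (WALL §2b R04 «localized minimiser flat there», `hudict`'s `f 0 = 0`), i.e. (44) about `U₀ = 1`):
   **`landauCorrection_real_binders_flat`** — the cut-off triple + `IsClosed` for `landauCf L 1 k S S′` with NO background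
   hypothesis and NO number (S64 f3 `regime_exists`∕`pdev_one` into S64 f2), k-uniform, unconditional.
NOT DONE (said): the END junction itself (S76 f2 ∕ S80 f6 fired with `Cf := landauCf`, R11's names replaced by the
background datum + `h52loc` + four level-free numbers) — journal OFFER l.20076, on the owner's GO only; the pinned twin
(CfP `ShellMeasureLandauCfPinned.conj_binders_of_local` over §2) likewise.
-/

noncomputable section

open scoped BigOperators
open NormedSpace Finset Metric

namespace Summit.QuantumFields.BalabanUV.T4Continuum.ShellMeasureLandauCorrectionB7Local

open Literature.MathematicalPhysics.QuantumFieldTheory.Balaban1983to89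
open B7Prop1Explicit (Site e hol plaqWord U1)
open B7Prop2Explicit (pdev pdev_nonneg le_pdev hol_plaqWord_self AvgClosed C0 c2')
open B7Prop1Local (InBox PlaqIn AgreeOn loK bondHiK clampCfg clampCfg_agree clampCfg_mem pdevOn pdevOn_nonneg
  pdev_clampCfg_le)
open B13Contraction113 (QuadAnalytic)
open ShellMeasureAverageProp4General (C1cov O1cov C2cov C1cov_pos)
open ShellMeasureLandauCorrectionB7 (scaleIns landauCf landauRad norm_landauCf_le differentiableOn_landauCf)
open ShellMeasureAverageLocality148 (agreeOn_rfl logCovIter_congr linCovIter_congr)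
open ShellMeasureLandauFixedPoint (quadAnalytic_of_frechet)

variable {d : ℕ}

section General

variable {𝔸 : Type*} [NormedRing 𝔸] [NormedAlgebra ℂ 𝔸] [CompleteSpace 𝔸] [NormOneClass 𝔸]

/-! ## §1 `C_k(U₀, ·)` reads the background on the box of the output bond only; located plaquette deviations -/

omit [NormOneClass 𝔸] in
/-- **`C_k(U₀, A)(c)` IS LOCAL IN THE BACKGROUND**: two backgrounds agreeing on the bonds of `B^k(c₋) ∪ B^k(c₊) =
[loK L k c₋, bondHiK L k c₋ κ]` give the same `landauCf L · k S S′ A c` (S68 (b)'s `logCovIter_congr − linCovIter_congr` with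
the field fixed; print: [Balaban1985Averaging] p. 31 «the same locality properties as the averages Ū^k», p. 24). [folklore] -/
theorem landauCf_congr_background {L : ℕ} (hL : 1 ≤ L) {U₀ U₀' : Site d → Fin d → 𝔸ˣ} (k : ℕ)
    (S S' : Finset (Site d × Fin d)) (A : S → 𝔸) (c : S')
    (h : AgreeOn (loK L k c.1.1) (bondHiK L k c.1.1 c.1.2) U₀ U₀') :
    landauCf L U₀ k S S' A c = landauCf L U₀' k S S' A c := by
  unfold landauCf
  rw [logCovIter_congr L hL k c.1.1 c.1.2 h agreeOn_rfl, linCovIter_congr L hL k c.1.1 c.1.2 h agreeOn_rfl]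

/-- The box `[loK L k q, bondHiK L k q κ]` is a genuine box (`L ≥ 1`). [folklore] -/
theorem loK_le_bondHiK {L : ℕ} (hL : 1 ≤ L) (k : ℕ) (q : Site d) (κ : Fin d) :
    ∀ i, loK L k q i ≤ bondHiK L k q κ i := fun i => by
  have hP : (1 : ℤ) ≤ (L : ℤ) ^ k := one_le_pow₀ (by exact_mod_cast hL)
  simp only [loK, bondHiK]; split_ifs <;> linarith

omit [NormedAlgebra ℂ 𝔸] [CompleteSpace 𝔸] [NormOneClass 𝔸] in
/-- A plaquette bound `‖V(∂p) − 1‖ ≤ a` for the non-degenerate unit plaquettes INSIDE the box bounds the located deviation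
`pdevOn lo hi V ≤ a` (degenerate plaquettes `κ = ν` have holonomy `1`). [folklore] -/
theorem pdevOn_le_of_forall {lo hi : Site d} {V : Site d → Fin d → 𝔸ˣ} {a : ℝ} (ha : 0 ≤ a)
    (h : ∀ (x : Site d) (κ ν : Fin d), κ ≠ ν → PlaqIn lo hi (x, κ, ν) →
      ‖((hol V x (plaqWord κ ν) : 𝔸ˣ) : 𝔸) - 1‖ ≤ a) :
    pdevOn lo hi V ≤ a := by
  refine Real.iSup_le (fun p => ?_) ha
  obtain ⟨⟨x, κ, ν⟩, hp⟩ := p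
  rcases eq_or_ne κ ν with rfl | hκν
  · simp only [hol_plaqWord_self, Units.val_one, sub_self, norm_zero]; exact ha
  · exact h x κ ν hκν hp

omit [NormedAlgebra ℂ 𝔸] [CompleteSpace 𝔸] in
/-- The located deviation is at most the global one: S64's binder `pdev U₀ < α₀L^{−2k}` implies this file's. [folklore] -/
theorem pdevOn_le_pdev (lo hi : Site d) {V : Site d → Fin d → 𝔸ˣ} (hV : ∀ x κ, V x κ ∈ U1 𝔸) :
    pdevOn lo hi V ≤ pdev V :=
  Real.iSup_le (fun p => le_pdev hV p.1.1 p.1.2.1 p.1.2.2) (pdev_nonneg V)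

/-- S64's GLOBAL background binder is the special case: it gives the located binder at every output bond. [folklore] -/
theorem h52loc_of_h52 {L : ℕ} {G : Subgroup 𝔸ˣ} (hG : AvgClosed d L G) (k : ℕ) {U₀ : Site d → Fin d → 𝔸ˣ}
    (hU₀ : ∀ x κ, U₀ x κ ∈ G) {t : ℝ} (h52 : pdev U₀ < t) (S' : Finset (Site d × Fin d)) :
    ∀ c : S', pdevOn (loK L k c.1.1) (bondHiK L k c.1.1 c.1.2) U₀ < t := fun c =>
  (pdevOn_le_pdev (loK L k c.1.1) (bondHiK L k c.1.1 c.1.2) fun x κ => hG.le_U1 (hU₀ x κ)).trans_lt h52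

/-! ## §2 END-II's pair for `Cf := C_k(U₀, ·)` from the LOCATED background binder, S64's constants -/

section Local

variable (L : ℕ) (hL : 2 ≤ L) {G : Subgroup 𝔸ˣ} (hG : AvgClosed d L G) (k : ℕ)
  (U₀ : Site d → Fin d → 𝔸ˣ) (hU₀ : ∀ x κ, U₀ x κ ∈ G) {α₀ : ℝ} (hα : 0 < α₀)
  (hα3 : C0 d * α₀ ≤ 1 / 3) (hα4 : 4 * α₀ ≤ c2' d L) (hα6 : 4 * O1cov d * α₀ ≤ 1 / 3)
  (S S' : Finset (Site d × Fin d))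
  (h52loc : ∀ c : S', pdevOn (loK L k c.1.1) (bondHiK L k c.1.1 c.1.2) U₀ < α₀ * (((L : ℝ) ^ k)⁻¹) ^ 2)

include hG hU₀ h52loc in
/-- the clamped extension of `U₀` from the box of `c` is `G`-valued and satisfies S64's GLOBAL binder (52)
(`B7Prop1Local.clampCfg_mem`, `pdev_clampCfg_le`). [folklore] -/
theorem clamp_background (hL1 : 1 ≤ L) (c : S') :
    (∀ x κ, clampCfg (loK L k c.1.1) (bondHiK L k c.1.1 c.1.2) U₀ x κ ∈ G) ∧
      pdev (clampCfg (loK L k c.1.1) (bondHiK L k c.1.1 c.1.2) U₀) < α₀ * (((L : ℝ) ^ k)⁻¹) ^ 2 :=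
  ⟨clampCfg_mem hU₀,
    (pdev_clampCfg_le (loK_le_bondHiK hL1 k c.1.1 c.1.2) fun x κ => hG.le_U1 (hU₀ x κ)).trans_lt (h52loc c)⟩

include hL hG hU₀ hα hα3 hα4 hα6 h52loc in
/-- **(135) PER OUTPUT BOND FROM THE LOCATED BINDER**: `‖C_k(U₀, A)(c)‖ ≤ C2cov(d)·‖A‖²` for `‖A‖ ≤ landauRad(d, L)` — S64
`norm_landauCf_le` for the clamped extension of `U₀` from the box of `c`, whose `c`-component is `U₀`'s (§1). [folklore] -/
theorem norm_landauCf_apply_le_local {A : S → 𝔸} (hA : ‖A‖ ≤ landauRad d L) (c : S') :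
    ‖landauCf L U₀ k S S' A c‖ ≤ C2cov d * ‖A‖ ^ 2 := by
  have hL1 : 1 ≤ L := le_trans (by norm_num) hL
  obtain ⟨hVG, h52'⟩ := clamp_background L hG k U₀ hU₀ S' h52loc hL1 c
  rw [landauCf_congr_background hL1 k S S' A c (clampCfg_agree U₀).symm]
  exact (norm_le_pi_norm _ c).trans (norm_landauCf_le L hL hG k _ hVG hα hα3 hα4 hα6 h52' S S' hA)

include hL hG hU₀ hα hα3 hα4 hα6 h52loc in
/-- **END-II's `hCq` FROM THE LOCATED BINDER** (sup norm over the output bonds). [folklore] -/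
theorem norm_landauCf_le_local {A : S → 𝔸} (hA : ‖A‖ ≤ landauRad d L) :
    ‖landauCf L U₀ k S S' A‖ ≤ C2cov d * ‖A‖ ^ 2 := by
  have hC := C1cov_pos d
  have hC2 : 0 ≤ C2cov d := by unfold C2cov; positivity
  exact (pi_norm_le_iff_of_nonneg (mul_nonneg hC2 (sq_nonneg _))).2 fun c =>
    norm_landauCf_apply_le_local L hL hG k U₀ hU₀ hα hα3 hα4 hα6 S S' h52loc hA c

include hL hG hU₀ hα hα3 hα4 hα6 h52loc in
/-- **END-II's `hCd` FROM THE LOCATED BINDER**: `C_k(U₀, ·)` is `ℂ`-differentiable on `ball 0 (landauRad d L)` of `𝔸^S` —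
componentwise it is a component of S64's differentiable map for the clamped background of that component. [folklore] -/
theorem differentiableOn_landauCf_local : DifferentiableOn ℂ (landauCf L U₀ k S S') (ball 0 (landauRad d L)) := by
  have hL1 : 1 ≤ L := le_trans (by norm_num) hL
  have heq : landauCf L U₀ k S S' = fun A c =>
      landauCf L (clampCfg (loK L k c.1.1) (bondHiK L k c.1.1 c.1.2) U₀) k S S' A c := by
    funext A c
    exact landauCf_congr_background hL1 k S S' A c (clampCfg_agree U₀).symm
  rw [heq]
  refine differentiableOn_pi.2 fun c => ?_
  obtain ⟨hVG, h52'⟩ := clamp_background L hG k U₀ hU₀ S' h52loc hL1 c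
  exact differentiableOn_pi.1 (differentiableOn_landauCf L hL hG k _ hVG hα hα3 hα4 hα6 h52' S S') c

include hL hG hU₀ hα hα3 hα4 hα6 h52loc in
/-- **ROW S64 LOCATED — END-II's LANDAU-CORRECTION BINDER PAIR FOR B7's `C_k(U₀, ·)` FROM THE BACKGROUND'S PLAQUETTE
REGULARITY ON THE BOXES `B^k(c₋) ∪ B^k(c₊)`, `c ∈ S′`, ALONE.**  For `L ≥ 2`, `G` averaging-closed, `U₀` `G`-valued,
`0 < α₀`, `C₀α₀ ≤ 1∕3`, `4α₀ ≤ c₂′(d,L)`, `4·O1cov(d)·α₀ ≤ 1∕3` (S64's level-free numbers VERBATIM) and the LOCATED binder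
`∀ c ∈ S′, pdevOn (loK L k c₋) (bondHiK L k c₋ κ) U₀ < α₀·L^{−2k}` (nothing asked off the boxes): with
`Cf := landauCf L U₀ k S S′ : 𝔸^S → 𝔸^{S′}`, `C₂ := C2cov d`, `RC := landauRad d L` — `hCq : ∀ A, ‖A‖ < RC → ‖Cf A‖ ≤ C₂‖A‖²`
and `hCd : DifferentiableOn ℂ Cf (ball 0 RC)`, the exact shapes of END-II's binders.  S64 `landauCorrection_binders` is the
special case of a globally regular background (`h52loc_of_h52`). [folklore] -/
theorem landauCorrection_binders_local :
    (∀ A : S → 𝔸, ‖A‖ < landauRad d L → ‖landauCf L U₀ k S S' A‖ ≤ C2cov d * ‖A‖ ^ 2) ∧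
      DifferentiableOn ℂ (landauCf L U₀ k S S') (ball 0 (landauRad d L)) :=
  ⟨fun _ hA => norm_landauCf_le_local L hL hG k U₀ hU₀ hα hα3 hα4 hα6 S S' h52loc hA.le,
    differentiableOn_landauCf_local L hL hG k U₀ hU₀ hα hα3 hα4 hα6 S S' h52loc⟩

include hL hG hU₀ hα hα3 hα4 hα6 h52loc in
/-- … in B13's line-analytic form `QuadAnalytic Cf C₂ RC` (`ShellMeasureLandauFixedPoint.quadAnalytic_of_frechet`), the input
TYPE of `B13Contraction113.analytic_fixedPoint_113` ∕ `ShellMeasureLandauFixedPoint.landauCorrection_along`. [folklore] -/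
theorem landauCorrection_quadAnalytic_local : QuadAnalytic (landauCf L U₀ k S S') (C2cov d) (landauRad d L) :=
  quadAnalytic_of_frechet (landauCorrection_binders_local L hL hG k U₀ hU₀ hα hα3 hα4 hα6 S S' h52loc).1
    (landauCorrection_binders_local L hL hG k U₀ hU₀ hα hα3 hα4 hα6 S S' h52loc).2

end Local

/-! ## §3 The located binder read off a plaquette bound on the boxes ∕ off any co-tested plaquette set -/

section Reading

variable (L : ℕ) (hL : 2 ≤ L) {G : Subgroup 𝔸ˣ} (hG : AvgClosed d L G) (k : ℕ)
  (U₀ : Site d → Fin d → 𝔸ˣ) (hU₀ : ∀ x κ, U₀ x κ ∈ G) {α₀ : ℝ} (hα : 0 < α₀)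
  (hα3 : C0 d * α₀ ≤ 1 / 3) (hα4 : 4 * α₀ ≤ c2' d L) (hα6 : 4 * O1cov d * α₀ ≤ 1 / 3)
  (S S' : Finset (Site d × Fin d)) {a : ℝ} (ha0 : 0 ≤ a) (ha : a < α₀ * (((L : ℝ) ^ k)⁻¹) ^ 2)

include hL hG hU₀ hα hα3 hα4 hα6 ha0 ha in
/-- **THE PAIR FROM A PLAQUETTE BOUND ON THE BOXES**: `‖U₀(∂p) − 1‖ ≤ a` for the unit plaquettes inside
`B^k(c₋) ∪ B^k(c₊)`, `c ∈ S′`, with `0 ≤ a < α₀·L^{−2k}`, gives END-II's pair for `landauCf L U₀ k S S′` with S64's constants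
(`pdevOn_le_of_forall` into §2). [folklore] -/
theorem landauCorrection_binders_of_plaqSmall
    (hsmall : ∀ (c : S') (x : Site d) (κ ν : Fin d), κ ≠ ν →
      PlaqIn (loK L k c.1.1) (bondHiK L k c.1.1 c.1.2) (x, κ, ν) → ‖((hol U₀ x (plaqWord κ ν) : 𝔸ˣ) : 𝔸) - 1‖ ≤ a) :
    (∀ A : S → 𝔸, ‖A‖ < landauRad d L → ‖landauCf L U₀ k S S' A‖ ≤ C2cov d * ‖A‖ ^ 2) ∧
      DifferentiableOn ℂ (landauCf L U₀ k S S') (ball 0 (landauRad d L)) :=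
  landauCorrection_binders_local L hL hG k U₀ hU₀ hα hα3 hα4 hα6 S S'
    fun c => (pdevOn_le_of_forall ha0 (hsmall c)).trans_lt ha

include hL hG hU₀ hα hα3 hα4 hα6 ha0 ha in
/-- **… READ OFF ANY CO-TESTED PLAQUETTE SET `P`** containing the non-degenerate unit plaquettes of the boxes (at a live slot:
the fine plaquettes over the block `□^{∼4}`, with `a` the CORE ∕ COLLAR smallness — S80 f6's `hcore`∕`hcollar` TYPE; the
identification of `U₀` with the section's background is node O's). [folklore] -/
theorem landauCorrection_binders_of_cotests {P : Set (Site d × Fin d × Fin d)}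
    (hP : ∀ (c : S') (p : Site d × Fin d × Fin d), p.2.1 ≠ p.2.2 →
      PlaqIn (loK L k c.1.1) (bondHiK L k c.1.1 c.1.2) p → p ∈ P)
    (hco : ∀ p ∈ P, ‖((hol U₀ p.1 (plaqWord p.2.1 p.2.2) : 𝔸ˣ) : 𝔸) - 1‖ ≤ a) :
    (∀ A : S → 𝔸, ‖A‖ < landauRad d L → ‖landauCf L U₀ k S S' A‖ ≤ C2cov d * ‖A‖ ^ 2) ∧
      DifferentiableOn ℂ (landauCf L U₀ k S S') (ball 0 (landauRad d L)) :=
  landauCorrection_binders_of_plaqSmall L hL hG k U₀ hU₀ hα hα3 hα4 hα6 S S' ha0 ha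
    fun c x κ ν hκν hp => hco (x, κ, ν) (hP c (x, κ, ν) hκν hp)

end Reading

end General

/-! ## §4 The third binder `hCr` (real fields to real fields) and S64 f2's cut-off triple, from the located binder -/

section Real

open Set
open ShellMeasureLandauCorrectionReal (skewPi mem_skewPi isClosed_skewPi landauCf_mem_skewPi)
open B7Prop2Explicit (unitaryUnits avgClosed_unitaryUnits)

variable {𝔸 : Type*} [CStarAlgebra 𝔸] [Nontrivial 𝔸] {L : ℕ}
  (hL : 2 ≤ L) (k : ℕ) (U₀ : Site d → Fin d → 𝔸ˣ) (hU₀ : ∀ x κ, U₀ x κ ∈ unitaryUnits 𝔸) {α₀ : ℝ} (hα : 0 < α₀)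
  (hα3 : C0 d * α₀ ≤ 1 / 3) (hα4 : 4 * α₀ ≤ c2' d L) (hα6 : 4 * O1cov d * α₀ ≤ 1 / 3)
  (S S' : Finset (Site d × Fin d))
  (h52loc : ∀ c : S', pdevOn (loK L k c.1.1) (bondHiK L k c.1.1 c.1.2) U₀ < α₀ * (((L : ℝ) ^ k)⁻¹) ^ 2)

include hL hU₀ hα hα3 hα4 hα6 h52loc in
/-- **`hCr` ON THE BALL FROM THE LOCATED BINDER**: for a UNITARY background regular on the boxes, `A ∈ skewPi S` with
`‖A‖ < landauRad d L` gives `landauCf L U₀ k S S′ A ∈ skewPi S′` — coordinate `c` is that of S64 f2's `landauCf_mem_skewPi` for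
the clamped (unitary, globally regular) background of `c`. [folklore] -/
theorem landauCf_mem_skewPi_local {A : ↥S → 𝔸} (hAs : A ∈ skewPi ↥S) (hA : ‖A‖ < landauRad d L) :
    landauCf L U₀ k S S' A ∈ skewPi ↥S' := by
  have hL1 : 1 ≤ L := le_trans (by norm_num) hL
  rw [mem_skewPi]
  intro c
  obtain ⟨hVG, h52'⟩ := clamp_background L (avgClosed_unitaryUnits d L) k U₀ hU₀ S' h52loc hL1 c
  rw [landauCf_congr_background hL1 k S S' A c (clampCfg_agree U₀).symm]
  exact (mem_skewPi.1 (landauCf_mem_skewPi hL k _ hVG hα hα3 hα4 hα6 h52' S S' hAs hA)) c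

include hL hU₀ hα hα3 hα4 hα6 h52loc in
/-- **ROW S64 f2 LOCATED — `hCq`, `hCd`, `hCr` (+ `h𝓡𝒳`) FOR THE CUT-OFF MAP** `(ball 0 (landauRad d L)).indicator
(landauCf L U₀ k S S′)` with `𝓡𝒴′ := skewPi S`, `𝓡𝒳 := skewPi S′`, for a UNITARY background regular on the boxes
`B^k(c₋) ∪ B^k(c₊)`, `c ∈ S′`, only (S64 f2 `landauCorrection_real_binders` is the globally regular special case). [folklore] -/
theorem landauCorrection_real_binders_local :
    (∀ Z : ↥S → 𝔸, ‖Z‖ < landauRad d L →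
        ‖(ball (0 : ↥S → 𝔸) (landauRad d L)).indicator (landauCf L U₀ k S S') Z‖ ≤ C2cov d * ‖Z‖ ^ 2) ∧
      DifferentiableOn ℂ ((ball (0 : ↥S → 𝔸) (landauRad d L)).indicator (landauCf L U₀ k S S'))
        (ball 0 (landauRad d L)) ∧
      (∀ Z ∈ skewPi ↥S, (ball (0 : ↥S → 𝔸) (landauRad d L)).indicator (landauCf L U₀ k S S') Z ∈ skewPi ↥S') ∧
      IsClosed ((skewPi (𝔸 := 𝔸) ↥S' : AddSubgroup (↥S' → 𝔸)) : Set (↥S' → 𝔸)) := by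
  have hG := avgClosed_unitaryUnits d L (𝔸 := 𝔸)
  have heqOn : EqOn ((ball (0 : ↥S → 𝔸) (landauRad d L)).indicator (landauCf L U₀ k S S')) (landauCf L U₀ k S S')
      (ball 0 (landauRad d L)) := fun Z hZ => Set.indicator_of_mem hZ _
  refine ⟨fun Z hZ => ?_, ?_, fun Z hZs => ?_, isClosed_skewPi _⟩
  · rw [Set.indicator_of_mem (mem_ball_zero_iff.2 hZ)]
    exact norm_landauCf_le_local L hL hG k U₀ hU₀ hα hα3 hα4 hα6 S S' h52loc hZ.le
  · exact (differentiableOn_landauCf_local L hL hG k U₀ hU₀ hα hα3 hα4 hα6 S S' h52loc).congr heqOn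
  · by_cases hZ : Z ∈ ball (0 : ↥S → 𝔸) (landauRad d L)
    · rw [Set.indicator_of_mem hZ]
      exact landauCf_mem_skewPi_local hL k U₀ hU₀ hα hα3 hα4 hα6 S S' h52loc hZs (mem_ball_zero_iff.1 hZ)
    · rw [Set.indicator_of_notMem hZ]
      exact (skewPi ↥S').zero_mem

end Real

/-! ## §5 The flat face: the cut-off triple for `C_k(1, ·)` with no background hypothesis (the localized tuple's case) -/

section Flat

open Set
open ShellMeasureLandauCorrectionReal (skewPi isClosed_skewPi landauCorrection_real_binders)
open ShellMeasureLandauCorrectionB7Flat (regime_exists pdev_one)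
open B7Prop2Explicit (unitaryUnits)

variable {𝔸 : Type*} [CStarAlgebra 𝔸] [Nontrivial 𝔸]

/-- **THE CUT-OFF TRIPLE `hCq`∕`hCd`∕`hCr` (+ `h𝓡𝒳`) AT THE FLAT BACKGROUND, UNCONDITIONAL, k-UNIFORM**: for `L ≥ 2` and EVERY
`k`, `S`, `S′`, the map `(ball 0 (landauRad d L)).indicator (landauCf L 1 k S S′) : 𝔸^S → 𝔸^{S′}` ([B7] Prop. 4's `C_k(1, ·)`
in the `A`-currency, cut off outside the ball) satisfies END-II's three Landau-correction binders with `C₂ := C2cov d`,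
`RC := landauRad d L`, `𝓡𝒴′ := skewPi S`, `𝓡𝒳 := skewPi S′`, and `skewPi S′` is closed — NO background datum, NO number
(row S64 f2 `landauCorrection_real_binders` at `U₀ = 1`: unitary, `pdev 1 = 0` (S64 f3 `pdev_one`), `α₀` from S64 f3
`regime_exists`).  This is the case of END-II's LOCALIZED (classifier) tuple, whose defined plaquette variables are words of
the exponent field alone (`= 1` at the centre). [folklore] -/
theorem landauCorrection_real_binders_flat {L : ℕ} (hL : 2 ≤ L) (k : ℕ) (S S' : Finset (Site d × Fin d)) :
    (∀ Z : ↥S → 𝔸, ‖Z‖ < landauRad d L →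
        ‖(ball (0 : ↥S → 𝔸) (landauRad d L)).indicator
            (landauCf L (1 : Site d → Fin d → 𝔸ˣ) k S S') Z‖ ≤ C2cov d * ‖Z‖ ^ 2) ∧
      DifferentiableOn ℂ ((ball (0 : ↥S → 𝔸) (landauRad d L)).indicator
          (landauCf L (1 : Site d → Fin d → 𝔸ˣ) k S S')) (ball 0 (landauRad d L)) ∧
      (∀ Z ∈ skewPi ↥S, (ball (0 : ↥S → 𝔸) (landauRad d L)).indicator
          (landauCf L (1 : Site d → Fin d → 𝔸ˣ) k S S') Z ∈ skewPi ↥S') ∧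
      IsClosed ((skewPi (𝔸 := 𝔸) ↥S' : AddSubgroup (↥S' → 𝔸)) : Set (↥S' → 𝔸)) := by
  have hL1 : 1 ≤ L := le_trans (by norm_num) hL
  obtain ⟨α₀, hα, hα3, hα4, hα6⟩ := regime_exists d hL1
  have hL0 : (0 : ℝ) < L := by exact_mod_cast hL1
  have h52 : pdev (1 : Site d → Fin d → 𝔸ˣ) < α₀ * (((L : ℝ) ^ k)⁻¹) ^ 2 := by
    rw [pdev_one]; positivity
  exact landauCorrection_real_binders hL k 1 (fun _ _ => (unitaryUnits 𝔸).one_mem) hα hα3 hα4 hα6 h52 S S'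

end Flat

end Summit.QuantumFields.BalabanUV.T4Continuum.ShellMeasureLandauCorrectionB7Local

end
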